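import Summits.QuantumFields.YangMills.Theorems.ColdStartUniversalityLatticeLangevinWilsonEnergyApproximation
import HarnessLib

/-!
# Route `ColdStartUniversality` (fixed-cut-off `L²(μ_{β'})` package): generator-form Poincaré + ONE approximant in energy ⇒ ONE
# variance bound — the quantitative step of «generator-form Poincaré ⇒ `L²` decay» without smoothing hypothesis

Helper file (seat `ym-line-csu-p1`, g18; `--supports stmt-QuantumFields-27363`), penultimate part of the unconditional
Bakry–Gentil–Ledoux Thm 4.2.5 for the SU(2) SZZ dynamics (sequel: `…WilsonGeneratorPoincare`).

* `le_of_forall_le_add_mul` — bookkeeping (`x ≤ y + Bε` for all `ε ∈ (0,1]`, `B ≥ 0` ⇒ `x ≤ y`).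
* `variance_le_sq_integral_sub_const` — `Var_μ(G) ≤ ∫ (G − c)² dμ`.
* `mul_variance_le_of_generatorPoincare_of_eventually_le` — abstract: generator-form Poincaré for `F`, `τ⁻¹(∫F κ_τF − ∫F²) → ∫F·𝓛F`,
  and an eventual bound `𝓔_τ(F) ≤ M` give `λ Var(F) ≤ M`.
* ★ `mul_variance_le_of_generatorPoincare_of_approx` — if `λ ≥ 0` satisfies the generator-form Poincaré inequality on `C³`
  cylinders, `𝓔_h(G) ≤ E` for all `h`, and `F = f∘coords` has `‖G − F‖² ≤ Aε`, `𝓔_h(F − G) ≤ Aε` (small `h`), then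
  `λ Var(G) ≤ (1+t)² E + ((1+t)(1+t⁻¹) + λ(1+t⁻¹)) Aε` for every `t > 0` (`dirichletScale_add_le`, `sq_integral_add_le`).

THEOREMS ONLY, no definition, no sorry.  HONEST FRAMING: RECORD-rung R3 plumbing at FIXED cut-off; nothing K-uniform is proved;
no crux, rung or summit statement is proved; the Yang–Mills mass gap is NOT proved.
-/

set_option autoImplicit false

noncomputable section

namespace Summit.QuantumFields.YangMills.Theorems.ColdStartUniversality

open MeasureTheory ProbabilityTheory Filter Set Topology
open scoped BigOperators NNReal ENNReal
open Literature.Probability.Process Literature.MathematicalPhysics.QuantumFieldTheory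
open Literature.MathematicalPhysics.QuantumLattice (fundamentalRep fundamentalLatticeRep continuous_fundamentalRep)

/-! ## §1. Bookkeeping -/

/-- If `x ≤ y + B ε` for all `ε ∈ (0, 1]` with `B ≥ 0`, then `x ≤ y`. [folklore] -/
theorem le_of_forall_le_add_mul {x y B : ℝ} (hB : 0 ≤ B) (h : ∀ ε : ℝ, 0 < ε → ε ≤ 1 → x ≤ y + B * ε) : x ≤ y := by
  refine le_of_forall_pos_lt_add fun δ hδ => ?_
  set ε : ℝ := min 1 (δ / (B + 1)) with hε
  have hB1 : 0 < B + 1 := by linarith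
  have hεpos : 0 < ε := lt_min one_pos (div_pos hδ hB1)
  have hε1 : ε ≤ 1 := min_le_left _ _
  have hεδ : ε ≤ δ / (B + 1) := min_le_right _ _
  have h1 := h ε hεpos hε1
  have h2 : B * ε < δ := by
    calc B * ε ≤ B * (δ / (B + 1)) := mul_le_mul_of_nonneg_left hεδ hB
      _ < (B + 1) * (δ / (B + 1)) := mul_lt_mul_of_pos_right (by linarith) (div_pos hδ hB1)
      _ = δ := by field_simp
  linarith

variable {L : ℕ} [NeZero L]

/-- **The mean minimises the quadratic deviation**: `∫ (G − μG)² dμ_{β'} ≤ ∫ (G − c)² dμ_{β'}` for continuous `G` and every `c`. [folklore] -/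
theorem variance_le_sq_integral_sub_const (β' : ℝ) {G : GaugeConfig 3 L (Matrix.specialUnitaryGroup (Fin 2) ℂ) → ℝ}
    (hG : Continuous G) (c : ℝ) :
    ∫ x, (G x - ∫ z, G z ∂(wilsonMeasure (d := 3) (L := L) (fundamentalRep (Fin 2)) β')) ^ 2
        ∂(wilsonMeasure (d := 3) (L := L) (fundamentalRep (Fin 2)) β') ≤
      ∫ x, (G x - c) ^ 2 ∂(wilsonMeasure (d := 3) (L := L) (fundamentalRep (Fin 2)) β') := by
  classical
  haveI := secondCountableTopology_su2
  haveI := borelSpace_config L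
  set μ : Measure (GaugeConfig 3 L (Matrix.specialUnitaryGroup (Fin 2) ℂ)) :=
    wilsonMeasure (d := 3) (L := L) (fundamentalRep (Fin 2)) β' with hμ
  haveI : IsProbabilityMeasure μ :=
    isProbabilityMeasure_wilsonMeasure (d := 3) (L := L) (fundamentalRep (Fin 2)) (continuous_fundamentalRep (Fin 2)) β'
  have h : ∫ x, (G x - c - ∫ z, (G z - c) ∂μ) ^ 2 ∂μ ≤ ∫ x, (G x - c) ^ 2 ∂μ :=
    variance_le_sq_integral (L := L) β' (hG.sub continuous_const : Continuous fun x => G x - c)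
  have iG : Integrable G μ := integrable_of_continuous_of_compactSpace hG μ
  have hm : ∫ z, (G z - c) ∂μ = (∫ z, G z ∂μ) - c := by
    rw [integral_sub iG (integrable_const c), integral_const, probReal_univ, one_smul]
  have e : ∀ x, (G x - c - ∫ z, (G z - c) ∂μ) = G x - ∫ z, G z ∂μ := fun x => by rw [hm]; ring
  simp_rw [e] at h
  exact h

/-- **Generator-form Poincaré + the small-time limit of the semigroup form + an energy bound at small scales ⇒ a variance
bound**, abstract bookkeeping on a probability space: if `F = f∘c` satisfies `λ ∫(F − μF)² ≤ −∫ (F − μF) g` with `∫ g = 0`,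
`τ⁻¹(∫ F·A_τ − ∫ F²) → ∫ F g` as `τ ↓ 0`, and eventually `τ⁻¹(∫ F² − ∫ F·B_τ) ≤ M` (`A_τ = B_τ`), then `λ Var(F) ≤ M`. [folklore] -/
theorem mul_variance_le_of_generatorPoincare_of_eventually_le {X : Type*} [MeasurableSpace X] {μ : Measure X}
    [IsProbabilityMeasure μ] {ι : Type*} {f : (ι → ℝ) → ℝ} {c : X → ι → ℝ} {Fs g : X → ℝ} {A B : ℝ → X → ℝ} {lam M : ℝ}
    (hfeq : ∀ V, Fs V = f (c V)) (hg0 : ∫ V, g V ∂μ = 0)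
    (hgi : Integrable g μ) (hFgi : Integrable (fun V => Fs V * g V) μ)
    (hP : lam * ∫ V, (f (c V) - ∫ V', f (c V') ∂μ) ^ 2 ∂μ ≤ -∫ V, (f (c V) - ∫ V', f (c V') ∂μ) * g V ∂μ)
    (hT : Tendsto (fun τ : ℝ => τ⁻¹ * ((∫ V, f (c V) * A τ V ∂μ) - ∫ V, f (c V) * f (c V) ∂μ)) (𝓝[>] 0)
      (𝓝 (∫ V, f (c V) * g V ∂μ)))
    (hAB : ∀ τ V, A τ V = B τ V)
    (hbound : ∀ᶠ τ : ℝ in 𝓝[>] 0, τ⁻¹ * ((∫ V, Fs V * Fs V ∂μ) - ∫ V, Fs V * B τ V ∂μ) ≤ M) :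
    lam * ∫ V, (Fs V - ∫ V', Fs V' ∂μ) ^ 2 ∂μ ≤ M := by
  have e : ∀ V, f (c V) = Fs V := fun V => (hfeq V).symm
  simp only [e, hAB] at hP hT
  set m : ℝ := ∫ V', Fs V' ∂μ with hm
  have h1 : ∫ V, (Fs V - m) * g V ∂μ = ∫ V, Fs V * g V ∂μ := by
    have ee : ∀ V, (Fs V - m) * g V = Fs V * g V - m * g V := fun V => by ring
    simp_rw [ee]
    rw [integral_sub hFgi (hgi.const_mul m), integral_const_mul, hg0, mul_zero, sub_zero]
  rw [h1] at hP
  -- the limit is `≥ -M`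
  have hT' : Tendsto (fun τ : ℝ => τ⁻¹ * ((∫ V, Fs V * Fs V ∂μ) - ∫ V, Fs V * B τ V ∂μ)) (𝓝[>] 0)
      (𝓝 (-(∫ V, Fs V * g V ∂μ))) :=
    hT.neg.congr' (Eventually.of_forall fun τ => by ring)
  have hlim : -(∫ V, Fs V * g V ∂μ) ≤ M := le_of_tendsto hT' hbound
  linarith

/-! ## §2. The variance bound from one approximant -/

/-- **One approximant ⇒ one variance bound.**  Let `λ ≥ 0` satisfy the generator-form Poincaré inequality on `C³` cylinders, let
`G` be continuous with `𝓔_h(G) ≤ E` for all `h > 0`, and let `F = f∘coords` (`f` `C³`, compact support) satisfy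
`∫ (G − F)² dμ ≤ Aε` and `𝓔_h(F − G) ≤ Aε` for `0 < h ≤ h₀`.  Then for every `t > 0`,
`λ Var_μ(G) ≤ (1+t)² E + ((1+t)(1+t⁻¹) + λ(1+t⁻¹)) Aε`: generator form = `lim_h 𝓔_h(F)` (`tendsto_dirichletForm_semigroup`),
`𝓔_h(F) ≤ (1+t)𝓔_h(G) + (1+t⁻¹)𝓔_h(F − G)` (`dirichletScale_add_le`), `Var(G) ≤ (1+t)Var(F) + (1+t⁻¹)‖G − F‖²`.
[cite: BakryGentilLedoux2014, Thm 4.2.5 and §3.2] -/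
theorem mul_variance_le_of_generatorPoincare_of_approx (L : ℕ) [NeZero L] (β' : ℝ)
    (κ : ℝ≥0 → Kernel (GaugeConfig 3 L (Matrix.specialUnitaryGroup (Fin 2) ℂ))
      (GaugeConfig 3 L (Matrix.specialUnitaryGroup (Fin 2) ℂ))) [∀ t, IsMarkovKernel (κ t)]
    (hreal : ∀ (t : ℝ≥0) (x : GaugeConfig 3 L (Matrix.specialUnitaryGroup (Fin 2) ℂ))
        (Ω : Type) [MeasurableSpace Ω] (P : Measure Ω) [IsProbabilityMeasure P]
        (W : ℝ≥0 → Ω → (Edge 3 L × NoiseIdx 2 → ℝ)) (hW : IsFlatBrownian W P)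
        (U : ℝ≥0 → Ω → GaugeConfig 3 L (Matrix.specialUnitaryGroup (Fin 2) ℂ)),
        (∀ ω, U 0 ω = x) →
        (latticeLangevinDynamics (fundamentalLatticeRep 2) β').IsSolution (fundamentalRep (Fin 2))
          hW.natFiltration P W U →
        κ t x = P.map (U t))
    {lam : ℝ} (hlam : 0 ≤ lam)
    (hPgen : ∀ (f : (Edge 3 L × Fin 2 × Fin 2 × Bool → ℝ) → ℝ), ContDiff ℝ 3 f →
        let coords : GaugeConfig 3 L (Matrix.specialUnitaryGroup (Fin 2) ℂ) → (Edge 3 L × Fin 2 × Fin 2 × Bool → ℝ) :=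
          fun V q => (fun z : ℂ => if q.2.2.2 then z.im else z.re)
            ((fundamentalRep (Fin 2) (V q.1) : Matrix (Fin 2) (Fin 2) ℂ) q.2.1 q.2.2.1)
        let gen : GaugeConfig 3 L (Matrix.specialUnitaryGroup (Fin 2) ℂ) → ℝ := fun V =>
          (∑ i : Edge 3 L × Fin 2 × Fin 2 × Bool, fderiv ℝ f (coords V) (Pi.single i 1) *
              (fun z : ℂ => if i.2.2.2 then z.im else z.re)
                ((latticeLangevinDynamics (fundamentalLatticeRep 2) β').drift
                  (matrixConfig (fundamentalRep (Fin 2)) V) i.1 i.2.1 i.2.2.1) +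
          1 / 2 * ∑ i : Edge 3 L × Fin 2 × Fin 2 × Bool, ∑ j : Edge 3 L × Fin 2 × Fin 2 × Bool,
            fderiv ℝ (fun z => fderiv ℝ f z (Pi.single i 1)) (coords V) (Pi.single j 1) *
              ∑ n : Edge 3 L × NoiseIdx 2,
                (if n.1 = i.1 then (fun z : ℂ => if i.2.2.2 then z.im else z.re)
                  ((latticeLangevinDynamics (fundamentalLatticeRep 2) β').noise
                    (matrixConfig (fundamentalRep (Fin 2)) V) i.1 n.2 i.2.1 i.2.2.1) else 0) *
                (if n.1 = j.1 then (fun z : ℂ => if j.2.2.2 then z.im else z.re)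
                  ((latticeLangevinDynamics (fundamentalLatticeRep 2) β').noise
                    (matrixConfig (fundamentalRep (Fin 2)) V) j.1 n.2 j.2.1 j.2.2.1) else 0))
        lam * ∫ V, (f (coords V) - ∫ V', f (coords V') ∂(wilsonMeasure (d := 3) (L := L) (fundamentalRep (Fin 2)) β')) ^ 2
            ∂(wilsonMeasure (d := 3) (L := L) (fundamentalRep (Fin 2)) β') ≤
          -∫ V, (f (coords V) - ∫ V', f (coords V') ∂(wilsonMeasure (d := 3) (L := L) (fundamentalRep (Fin 2)) β')) *
            gen V ∂(wilsonMeasure (d := 3) (L := L) (fundamentalRep (Fin 2)) β'))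
    {G : GaugeConfig 3 L (Matrix.specialUnitaryGroup (Fin 2) ℂ) → ℝ} (hG : Continuous G) {E : ℝ}
    (hE : ∀ h : ℝ≥0, 0 < h →
      (h : ℝ)⁻¹ * ((∫ x, G x * G x ∂(wilsonMeasure (d := 3) (L := L) (fundamentalRep (Fin 2)) β')) -
        ∫ x, G x * (∫ y, G y ∂(κ h x)) ∂(wilsonMeasure (d := 3) (L := L) (fundamentalRep (Fin 2)) β')) ≤ E)
    {A ε t : ℝ} (ht : 0 < t)
    {f : (Edge 3 L × Fin 2 × Fin 2 × Bool → ℝ) → ℝ} (hf : ContDiff ℝ 3 f) (hfc : HasCompactSupport f)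
    {Fs : GaugeConfig 3 L (Matrix.specialUnitaryGroup (Fin 2) ℂ) → ℝ} (hFc : Continuous Fs)
    (hFs : ∀ V, Fs V = f (fun q => (fun z : ℂ => if q.2.2.2 then z.im else z.re)
      ((fundamentalRep (Fin 2) (V q.1) : Matrix (Fin 2) (Fin 2) ℂ) q.2.1 q.2.2.1)))
    (hL2 : ∫ x, (G x - Fs x) ^ 2 ∂(wilsonMeasure (d := 3) (L := L) (fundamentalRep (Fin 2)) β') ≤ A * ε)
    {h₀ : ℝ≥0} (hh₀ : 0 < h₀)
    (hEn : ∀ h : ℝ≥0, 0 < h → h ≤ h₀ →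
      (h : ℝ)⁻¹ * ((∫ x, (Fs x - G x) * (Fs x - G x) ∂(wilsonMeasure (d := 3) (L := L) (fundamentalRep (Fin 2)) β')) -
        ∫ x, (Fs x - G x) * (∫ y, (Fs y - G y) ∂(κ h x)) ∂(wilsonMeasure (d := 3) (L := L) (fundamentalRep (Fin 2)) β')) ≤
        A * ε) :
    lam * ∫ x, (G x - ∫ z, G z ∂(wilsonMeasure (d := 3) (L := L) (fundamentalRep (Fin 2)) β')) ^ 2
        ∂(wilsonMeasure (d := 3) (L := L) (fundamentalRep (Fin 2)) β') ≤
      (1 + t) ^ 2 * E + ((1 + t) * (1 + t⁻¹) + lam * (1 + t⁻¹)) * (A * ε) := by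
  classical
  haveI := secondCountableTopology_su2
  haveI := borelSpace_config L
  set μ : Measure (GaugeConfig 3 L (Matrix.specialUnitaryGroup (Fin 2) ℂ)) :=
    wilsonMeasure (d := 3) (L := L) (fundamentalRep (Fin 2)) β' with hμ
  haveI : IsProbabilityMeasure μ :=
    isProbabilityMeasure_wilsonMeasure (d := 3) (L := L) (fundamentalRep (Fin 2)) (continuous_fundamentalRep (Fin 2)) β'
  have ht1 : 0 ≤ 1 + t := by linarith
  have ht2 : 0 ≤ 1 + t⁻¹ := by positivity
  -- (1)–(3): generator-form Poincaré for `F`, the small-time limit, `∫ gen = 0`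
  have hP := hPgen f hf
  have hT := tendsto_dirichletForm_semigroup L β' κ hreal hf hfc
  have hg0 := integral_generator_wilson_eq_zero L β' hf hfc
  have hgc := continuous_generator (L := L) β' (hf.of_le (by norm_num))
  -- (4): the energy bound at small scales along `𝓝[>] 0`
  have hh₀R : (0 : ℝ) < h₀ := by exact_mod_cast hh₀
  have hbound : ∀ᶠ τ : ℝ in 𝓝[>] 0,
      τ⁻¹ * ((∫ V, Fs V * Fs V ∂μ) - ∫ V, Fs V * (∫ y, Fs y ∂(κ τ.toNNReal V)) ∂μ) ≤ (1 + t) * E + (1 + t⁻¹) * (A * ε) := by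
    filter_upwards [Ioc_mem_nhdsGT hh₀R] with τ hτ
    have hτpos : 0 < τ := hτ.1
    have hτ' : 0 < τ.toNNReal := Real.toNNReal_pos.2 hτpos
    have hτ'le : τ.toNNReal ≤ h₀ := by
      rw [← Real.toNNReal_coe (r := h₀)]; exact Real.toNNReal_le_toNNReal hτ.2
    have hcoe : ((τ.toNNReal : ℝ≥0) : ℝ) = τ := Real.coe_toNNReal _ hτpos.le
    have hv : Continuous fun x => Fs x - G x := hFc.sub hG
    have hadd := dirichletScale_add_le L β' κ hreal τ.toNNReal hG hv ht
    have e : ∀ x, G x + (Fs x - G x) = Fs x := fun x => by ring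
    simp_rw [e] at hadd
    have h1 := hE τ.toNNReal hτ'
    have h2 := hEn τ.toNNReal hτ' hτ'le
    rw [hcoe] at h1 h2
    calc τ⁻¹ * ((∫ V, Fs V * Fs V ∂μ) - ∫ V, Fs V * (∫ y, Fs y ∂(κ τ.toNNReal V)) ∂μ)
        ≤ τ⁻¹ * ((1 + t) * ((∫ x, G x * G x ∂μ) - ∫ x, G x * (∫ y, G y ∂(κ τ.toNNReal x)) ∂μ) +
            (1 + t⁻¹) * ((∫ x, (Fs x - G x) * (Fs x - G x) ∂μ) -
              ∫ x, (Fs x - G x) * (∫ y, (Fs y - G y) ∂(κ τ.toNNReal x)) ∂μ)) :=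
          mul_le_mul_of_nonneg_left hadd (inv_nonneg.2 hτpos.le)
      _ = (1 + t) * (τ⁻¹ * ((∫ x, G x * G x ∂μ) - ∫ x, G x * (∫ y, G y ∂(κ τ.toNNReal x)) ∂μ)) +
            (1 + t⁻¹) * (τ⁻¹ * ((∫ x, (Fs x - G x) * (Fs x - G x) ∂μ) -
              ∫ x, (Fs x - G x) * (∫ y, (Fs y - G y) ∂(κ τ.toNNReal x)) ∂μ)) := by ring
      _ ≤ (1 + t) * E + (1 + t⁻¹) * (A * ε) :=
          add_le_add (mul_le_mul_of_nonneg_left h1 ht1) (mul_le_mul_of_nonneg_left h2 ht2)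
  -- (5): `λ Var(F) ≤ (1+t)E + (1+t⁻¹)Aε`
  have hVarF : lam * ∫ V, (Fs V - ∫ V', Fs V' ∂μ) ^ 2 ∂μ ≤ (1 + t) * E + (1 + t⁻¹) * (A * ε) :=
    mul_variance_le_of_generatorPoincare_of_eventually_le (μ := μ) (Fs := Fs)
      (B := fun (τ : ℝ) (x : GaugeConfig 3 L (Matrix.specialUnitaryGroup (Fin 2) ℂ)) => ∫ y, Fs y ∂(κ τ.toNNReal x))
      hFs hg0 (integrable_of_continuous_of_compactSpace hgc μ)
      (integrable_of_continuous_of_compactSpace (hFc.mul hgc) μ) hP hT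
      (fun τ x => integral_congr_ae (Eventually.of_forall fun y => (hFs y).symm)) hbound
  -- (6): `Var(G) ≤ (1+t) Var(F) + (1+t⁻¹) ‖G − F‖²`
  set mF : ℝ := ∫ V', Fs V' ∂μ with hmF
  have hVarG : ∫ x, (G x - ∫ z, G z ∂μ) ^ 2 ∂μ ≤ (1 + t) * ∫ V, (Fs V - mF) ^ 2 ∂μ + (1 + t⁻¹) * (A * ε) := by
    have h1 := variance_le_sq_integral_sub_const (L := L) β' hG mF
    have ha' : Continuous fun x => Fs x - mF := hFc.sub continuous_const
    have hb' : Continuous fun x => G x - Fs x := hG.sub hFc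
    have h2 := sq_integral_add_le (ν := μ) ha' hb' ht
    have e : ∀ x, (Fs x - mF) + (G x - Fs x) = G x - mF := fun x => by ring
    simp_rw [e] at h2
    calc ∫ x, (G x - ∫ z, G z ∂μ) ^ 2 ∂μ ≤ ∫ x, (G x - mF) ^ 2 ∂μ := h1
      _ ≤ (1 + t) * ∫ x, (Fs x - mF) ^ 2 ∂μ + (1 + t⁻¹) * ∫ x, (G x - Fs x) ^ 2 ∂μ := h2
      _ ≤ (1 + t) * ∫ V, (Fs V - mF) ^ 2 ∂μ + (1 + t⁻¹) * (A * ε) := by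
          have := mul_le_mul_of_nonneg_left hL2 ht2; linarith
  -- (7): combine
  have hVF0 : 0 ≤ ∫ V, (Fs V - mF) ^ 2 ∂μ := integral_nonneg fun _ => sq_nonneg _
  calc lam * ∫ x, (G x - ∫ z, G z ∂μ) ^ 2 ∂μ
      ≤ lam * ((1 + t) * ∫ V, (Fs V - mF) ^ 2 ∂μ + (1 + t⁻¹) * (A * ε)) := mul_le_mul_of_nonneg_left hVarG hlam
    _ = (1 + t) * (lam * ∫ V, (Fs V - mF) ^ 2 ∂μ) + lam * (1 + t⁻¹) * (A * ε) := by ring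
    _ ≤ (1 + t) * ((1 + t) * E + (1 + t⁻¹) * (A * ε)) + lam * (1 + t⁻¹) * (A * ε) := by
        have := mul_le_mul_of_nonneg_left hVarF ht1; linarith
    _ = (1 + t) ^ 2 * E + ((1 + t) * (1 + t⁻¹) + lam * (1 + t⁻¹)) * (A * ε) := by ring

end Summit.QuantumFields.YangMills.Theorems.ColdStartUniversality

end
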